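import Summits.BirchSwinnertonDyer.BirchSwinnertonDyer.Theorems.PrintCf2RamifiedOffTYZPrimeBlockDigits
import Summits.BirchSwinnertonDyer.BirchSwinnertonDyer.Theorems.PrintCf2RamifiedOffTYZLevelTwoGenusPoint
import Summits.BirchSwinnertonDyer.BirchSwinnertonDyer.Theorems.PrintCf2RamifiedOffTYZPartnerShaLevelTwoR2
import Literature.NumberTheory.EllipticCurves.TianYuanZhang2017.GenusPointBlockThm35Displays
import HarnessLib

/-!
# The two-prime readings of C⁺ FULLY BY NAME: Theorem 3.5 at the prime block is now a DISPLAY, so the invisible-R2 headline carries only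
# named facts of 𝔅_ram, displays of [TianYuanZhang2017] §3, and the row's two structural bits
# (crux stmt-BirchSwinnertonDyer-20509 `RamifiedOffTYZOfFacts`, line `offtyz-v7`, LEAD g26, cycle 27, part 3)

HONEST FRAMING (cell `bsd-print-cf2`, route `PrintCf2`; `--supports stmt-BirchSwinnertonDyer-20509`; theorems only, `def`-free, no `sorry`).
BSD is not proved by any of this; no class is closed by this file; item 23431 (C⁺) and crux 20509 stay OPEN.

Part 1 (`…PrimeBlockDigits`, p787913) discharged the PARITY hypotheses of the two-prime interface (`𝓛(l)` even, `𝓛(m)` odd) and the analytic-rank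
hypothesis on `l`; the ONE display-shaped hypothesis left was `h35m`/`h35q` — Theorem 3.5's main clause for the PRIME BLOCK `m` of `n = l·m`, read in
`A(ℍ′_n)` («`2·P(m) − u·𝓛(m)·α_m` is torsion»), which the tree displayed only at the top block.  The display file
`Literature/…/TianYuanZhang2017/GenusPointBlockThm35Displays.lean` (p788254, this seat) records Theorem 3.5 at EVERY block (`Thm35AtBlocks`, one named
fact `tyz_genusPointBlockData` refining `tyz_cmPointCompositumData`).  THIS FILE consumes it:

* §1 `exists_h35_prime` — **`h35m` BY NAME**: on `n = l·m` (`m ≡ 5, 7 (mod 8)` prime), granted conjunct 5 and the displays, for every generator `α`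
  of the free part of `A(K_m)⁻`: `2·P(m) − (s·𝓛(m))·α` is torsion in `A(ℍ′_n)`, `s = ±1`; `exists_generatesFreePart_prime` — such `α` exist (GZK +
  conjunct 5: `ord_{s=1} L(E_m, s) = 1`).
* §2 layer one / depth two on the two-prime sectors with NO display-shaped hypothesis (`twoDivisible_genusPoint_iff_genusPeriod`,
  `fourDivisible_genusPoint_trichotomy`).
* §3 ★★★ `levelTwo_iff_genusPeriod_depth` / `levelTwo_iff_genusPeriod_depth_eq_one` — **C⁺ on the invisible R2 stratum** (`n = lq`, `l ≡ 1`,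
  `q ≡ 7 (mod 8)`, `ord_{s=1} L(E_n,s) = 1`, `ρ(n) = 0`, generator `(2s², Y)`), hypotheses = conjuncts 1, 2, 4, 5 of 𝔅_ram + `D.Printed` + CM-point
  layer + (B) + the two structural bits: with `δ(l) := [ord_{s=1} L(E_l,s) = 0 ∧ #Sel₄(E_l) = 2⁴]`,
  **`¬δ(l)` ⟹ (C⁺ at `lq` ⟺ `Z(lq)` has depth EXACTLY ONE in `A(ℍ′_n)/tors`)** — a statement with NO auxiliary object — and
  **`δ(l)` ⟹ (C⁺ at `lq` ⟺ `Z(lq) ∈ 2A + tors ∧ Z(lq) − α_q ∉ 4A + tors`)** for every generator `α_q` of `A(K_q)⁻`.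
* §3b ★★★ `levelTwo_iff_genusPeriod_not_twoDivisible_of_partner_R2` — the PARTNER-TRIVIAL half of R2 (`Ш(A_{lq})[2] = 0`, where `ρ(lq) = 1` and
  `#Sel₄ = 2⁶` are theorems, g20): composing g20's «C⁺ ⟺ `[P(lq)] ≠ 0`» with §2's layer one: **C⁺ at `lq` ⟺ `Z(lq) ∉ 2A(ℍ′_{lq}) + tors`** — a
  LAYER-ONE law of the genus period, by name (GZK + conjuncts 2, 4, 5 + displays).
* §3c ★★ `levelTwo_two_primes_iff_visible` — the VISIBLE part of both sectors (`[Q₁] ≠ 0`), DIGIT-FREE: **C⁺ at `lm` ⟺ `[Z(lm)] = [Q₁]`** (g10's two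
  visible theorems merged: at layer one `c·α_m` is invisible), every auxiliary hypothesis a named fact or a display.
* §4 `…_of_bundle` — 𝔅_ram VERBATIM + `tyz_genusPointBlockData` ⟹ the `¬δ` reading.

THE R2 TABLE AFTER THIS FILE (jump-one rows `n = lq`, `ord L(E_n) = 1`; all BY NAME modulo conjuncts 1, 2, 4, 5 + displays + the row's structural
bits): partner-trivial half (`Ш(A)[2] = 0`, `ρ = 1`): C⁺ ⟺ depth `Z(lq)` = 0; `ρ = 0`, visible (`d(h) ∈ {l, 2l}`): C⁺ ⟺ `[Z(lq)] = [Q₁]`;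
`ρ = 0`, invisible (`d(h) = 2`), `¬δ(l)`: C⁺ ⟺ depth `Z(lq)` = 1; `ρ = 0`, invisible, `δ(l)`: C⁺ ⟺ `Z ∈ 2A + tors ∧ Z − α_q ∉ 4A + tors`.

So the beyond-print object of the line on R2 is isolated with nothing else in the statement: the DEPTH of the genus period `Z(lq) = Σ_{t ∈ 2Cl(K_{lq})} z^t`
in `A(L_{lq}(i))` modulo torsion (exactly one ⟺ BSD₂(E_{lq}) on the `¬δ` rows of the invisible stratum).  No print decides it (CM values of level-32
modular units; Monsky 1990 Remark (3) is the nearest printed sentence, a conjecture).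

References: [cite: TianYuanZhang2017, §3.1 (p0011 L27–L36, L53–L73), Thm. 3.5 (p0011 L94–L100), Lemma 3.18, Thm. 1.2, §1 (1.1)];
[cite: BurungaleFlach2024, Thm 1.1 / Cor. 3]; [cite: KoblitzECMF1993, Ch. II §5, Theorem (p. 84)]; [cite: Darmon2004, Thm. 3.22];
[cite: SilvermanAEC2009, Prop. X.1.4, X.4.9]; [cite: Monsky1990MockHeegner, Remark (3) after Thm. 5.14]; tree: part 1 `…PrimeBlockDigits`, g25
`…RankZeroDigit{DepthTwo,Invisible}`, g18 `…InvisibleGenerator`, g10 `…LevelTwoTwoPrimes`, g3 `…LevelTwoGenusPoint`.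
-/

noncomputable section

open scoped Classical

open WeierstrassCurve WeierstrassCurve.Affine WeierstrassCurve.Affine.Point
  Literature.NumberTheory.EllipticCurves Literature.NumberTheory.EllipticCurves.Rank1Residual
  Summit.BirchSwinnertonDyer.Rank1Residual
  Literature.NumberTheory.EllipticCurves.TianYuanZhang2017
  Literature.NumberTheory.EllipticCurves.TianYuanZhang2017.W2
  Literature.NumberTheory.QuadraticFields.RedeiReichardt
  Summit.BirchSwinnertonDyer.PrintCf2.LevelTwoTwoPrimes
  Summit.BirchSwinnertonDyer.PrintCf2.RankZeroDigitDepthTwo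

set_option autoImplicit false

namespace Summit.BirchSwinnertonDyer.PrintCf2.TwoPrimesByName

open Summit.BirchSwinnertonDyer.PrintCf2.PrimeBlockDigits

/-! ## §1 Theorem 3.5 at the prime block, BY NAME (the lineage's `h35m` / `h35q` discharged) -/

section PrimeBlock

variable {n : ℕ}

/-- The prime block `m` of `n = l·m` is a divisor of `n`. [folklore] -/
theorem right_mem_divisors {l m : ℕ} (hl : l.Prime) (hm : m.Prime) (hn : n = l * m) : m ∈ n.divisors :=
  Nat.mem_divisors.mpr ⟨hn ▸ Dvd.intro_left l rfl, hn ▸ Nat.mul_ne_zero hl.ne_zero hm.ne_zero⟩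

/-- **`h35m` BY NAME.**  On the two-prime sector `n = l·m` (`m ≡ 5, 7 (mod 8)` prime), granted conjunct 5 of 𝔅_ram (`𝓛(m)` odd, hence `≠ 0`)
and the displays `scriptLSpec` + (B) `Thm35AtBlocks`: for every generator `α` of the free part of `A(K_m)⁻`, **`2·P(m) − (s·𝓛(m))·α` is torsion
in `A(ℍ′_n)` for a sign `s = ±1`** (`ρ(m) = 0`). [cite: TianYuanZhang2017, Thm. 3.5 (p0011 L94–L95), Thm. 1.2, §1 (ρ)] -/
theorem exists_h35_prime (h12 : thm12_parity_of_scriptL') {l m : ℕ} (hl : l.Prime) (hm : m.Prime) (hm8 : m % 8 = 5 ∨ m % 8 = 7)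
    (hn : n = l * m) (D : GenusPointData n) (hLs : D.scriptLSpec) (hBl : D.Thm35AtBlocks)
    (α : APoint (GenusField m)) (hα : GeneratesFreePart m α) :
    ∃ s : ℤ, (s = 1 ∨ s = -1) ∧
      IsOfFinAddOrder ((2 : ℤ) • D.P m - (s * D.scriptL m) • Point.map (D.embK m (right_mem_divisors hl hm hn)) α) := by
  have hodd : Odd (D.scriptL m) := odd_scriptL_right h12 hl hm hm8 hn D hLs
  have hL0 : D.scriptL m ≠ 0 := fun h => by simp [h] at hodd
  exact hBl.exists_two_smul_P_sub_smul_prime hm hm8 (right_mem_divisors hl hm hn) hL0 α hα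

/-- A generator of the free part of `A(K_q)⁻` EXISTS for a prime `q ≡ 5, 7 (mod 8)`, and is non-torsion (GZK + conjunct 5: `ord_{s=1} L(E_q,s) = 1`).
[cite: TianYuanZhang2017, §3.1 (p0011 L27–L36), Thm. 1.2] [cite: Darmon2004, Thm. 3.22] -/
theorem exists_generatesFreePart_prime (hGZK : rank_eq_analyticRank_of_analyticRank_le_one) (h12 : thm12_parity_of_scriptL')
    {q : ℕ} (hq : q.Prime) (hq8 : q % 8 = 5 ∨ q % 8 = 7) :
    ∃ α : APoint (GenusField q), GeneratesFreePart q α ∧ ¬ IsOfFinAddOrder α :=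
  LevelTwo.exists_generatesFreePart_not_isOfFinAddOrder hGZK hq.squarefree (analyticRank_prime_eq_one h12 hq hq8)

end PrimeBlock

/-! ## §2 Layer one and depth two on the two-prime sector, with NO display-shaped hypothesis left -/

section TwoPrimes

variable {n : ℕ}

/-- **Layer one, fully by name**: granted conjuncts 2, 4, 5 of 𝔅_ram and the displays (recursion, `ε`-types, integrality, (B)), on `n = l·m`
(`l ≡ 1`, `m ≡ 5, 7 (mod 8)` primes): `P(lm) ∈ 2A + tors ⟺ Z(lm) ∈ 2A + tors`.
[cite: TianYuanZhang2017, §3.1 (p0011 L67–L73), Thm. 3.5, Thm. 1.2] [cite: BurungaleFlach2024, Thm 1.1 / Cor. 3] -/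
theorem twoDivisible_genusPoint_iff_genusPeriod (hGZK : rank_eq_analyticRank_of_analyticRank_le_one)
    (hmod : WeierstrassCurve.hasEntireLFunction_rat) (hCM0 : bsdTriple_of_hasCM_of_L_one_ne_zero) (h12 : thm12_parity_of_scriptL')
    {l m : ℕ} (hl : l.Prime) (hm : m.Prime) (hl8 : l % 8 = 1) (hm8 : m % 8 = 5 ∨ m % 8 = 7) (hn : n = l * m)
    (D : GenusPointData n) (hLs : D.scriptLSpec) (hrec : D.recursion) (heps : D.epsSpec) (hBl : D.Thm35AtBlocks) :
    (∃ y : APoint D.H, IsOfFinAddOrder (D.P n - (2 : ℤ) • y)) ↔ ∃ y : APoint D.H, IsOfFinAddOrder (D.Z n - (2 : ℤ) • y) := by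
  obtain ⟨α, hα, -⟩ := exists_generatesFreePart_prime hGZK h12 hm hm8
  obtain ⟨s, hs, h35m⟩ := exists_h35_prime h12 hl hm hm8 hn D hLs hBl α hα
  exact twoDivisible_genusPoint_iff_genusPeriod_of_facts hmod hCM0 h12 hl hm hl8 hm8 hn D hLs hrec heps hs h35m

/-- ★★ **Depth two, fully by name**: granted conjuncts 2, 4, 5 of 𝔅_ram and the displays (incl. (B)), on `n = l·m` as above, for every
generator `α` of the free part of `A(K_m)⁻` (mapped into `A(ℍ′_n)`):
if `ord_{s=1} L(E_l,s) = 0 ∧ #Sel₄(E_l) ≠ 2⁴`: `P ∈ 4A + tors ⟺ Z ∈ 4A + tors`; if `ord L(E_l) = 0 ∧ #Sel₄(E_l) = 2⁴`: `P ∈ 4A + tors ⟺ Z − α ∈ 4A + tors`;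
if `ord L(E_l) ≠ 0`: `P = Z`. [cite: TianYuanZhang2017, §3.1, Thm. 3.5, Thm. 1.2, §1 (1.1)] [cite: BurungaleFlach2024, Thm 1.1 / Cor. 3] -/
theorem fourDivisible_genusPoint_trichotomy (hmod : WeierstrassCurve.hasEntireLFunction_rat)
    (hCM0 : bsdTriple_of_hasCM_of_L_one_ne_zero) (h12 : thm12_parity_of_scriptL')
    {l m : ℕ} (hl : l.Prime) (hm : m.Prime) (hl8 : l % 8 = 1) (hm8 : m % 8 = 5 ∨ m % 8 = 7) (hn : n = l * m)
    (D : GenusPointData n) (hLs : D.scriptLSpec) (hrec : D.recursion) (heps : D.epsSpec) (hBl : D.Thm35AtBlocks)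
    (α : APoint (GenusField m)) (hα : GeneratesFreePart m α) :
    ((congruentNumberCurve l).analyticRank = 0 → Nat.card ((congruentNumberCurve l).selmerGroup 4) ≠ 2 ^ 4 →
      ((∃ y : APoint D.H, IsOfFinAddOrder (D.P n - (4 : ℤ) • y)) ↔ ∃ y : APoint D.H, IsOfFinAddOrder (D.Z n - (4 : ℤ) • y))) ∧
    ((congruentNumberCurve l).analyticRank = 0 → Nat.card ((congruentNumberCurve l).selmerGroup 4) = 2 ^ 4 →
      ((∃ y : APoint D.H, IsOfFinAddOrder (D.P n - (4 : ℤ) • y)) ↔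
        ∃ y : APoint D.H, IsOfFinAddOrder (D.Z n - Point.map (D.embK m (right_mem_divisors hl hm hn)) α - (4 : ℤ) • y))) ∧
    ((congruentNumberCurve l).analyticRank ≠ 0 → D.P n = D.Z n) := by
  obtain ⟨s, hs, h35m⟩ := exists_h35_prime h12 hl hm hm8 hn D hLs hBl α hα
  exact fourDivisible_genusPoint_trichotomy_of_facts hmod hCM0 h12 hl hm hl8 hm8 hn D hLs hrec heps hs h35m

end TwoPrimes

/-! ## §3 C⁺ on the invisible R2 stratum: named facts + displays + the row's two structural bits ONLY -/

section InvisibleR2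

variable {n : ℕ}

/-- ★★★ **C⁺ ON THE INVISIBLE R2 STRATUM — EVERY AUXILIARY HYPOTHESIS A NAMED FACT OR A DISPLAY.**  Granted conjuncts 1 (GZK), 2 (modularity),
4 (CM rank-zero BSD), 5 (TYZ Thm 1.2′) of 𝔅_ram; primes `l ≡ 1`, `q ≡ 7 (mod 8)`, `n = lq` with `ord_{s=1} L(E_n, s) = 1`; a display package `D`
with `Printed`, the CM-point layer and (B) Thm 3.5 at the blocks; and the two STRUCTURAL bits of the row — `ρ(n) = 0` and an `A_n`-generator of the
invisible shape `(2s², Y)`.  Then, for EVERY generator `α` of the free part of `A(K_q)⁻` and the digit `δ(l) := [ord_{s=1} L(E_l,s) = 0 ∧ #Sel₄(E_l) = 2⁴]`: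
**`¬δ(l)` ⟹ (C⁺ at `lq` ⟺ `Z(lq) ∈ 2A + tors ∧ Z(lq) ∉ 4A + tors`);  `δ(l)` ⟹ (C⁺ at `lq` ⟺ `Z(lq) ∈ 2A + tors ∧ Z(lq) − α ∉ 4A + tors`).**
[cite: TianYuanZhang2017, §3.1, Thm. 3.5, Lemma 3.18, Thm. 1.2, §1 (1.1)] [cite: BurungaleFlach2024, Thm 1.1 / Cor. 3] [cite: Darmon2004, Thm. 3.22]
[cite: KoblitzECMF1993, Ch. II §5, Theorem (p. 84)] [cite: SilvermanAEC2009, Prop. X.1.4, X.4.9] -/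
theorem levelTwo_iff_genusPeriod_depth (hGZK : rank_eq_analyticRank_of_analyticRank_le_one)
    (hmod : WeierstrassCurve.hasEntireLFunction_rat) (hCM0 : bsdTriple_of_hasCM_of_L_one_ne_zero) (h12 : thm12_parity_of_scriptL')
    {l q : ℕ} (hl : l.Prime) (hq : q.Prime) (hl8 : l % 8 = 1) (hq8 : q % 8 = 7) (hn : n = l * q)
    (hr : (congruentNumberCurve n).analyticRank = 1)
    (D : GenusPointData n) (hPr : D.Printed) (hC : D.CMPointCompositumPrinted) (hBl : D.Thm35AtBlocks)
    (hρ : (rhoSubgroup n).index = 1)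
    {X Y : ℚ} (h : (Atwo n).toAffine.Nonsingular X Y) {s : ℚ} (hs : s ≠ 0) (hX : X = 2 * s ^ 2)
    (hgen : ∀ P : (Atwo n).toAffine.Point, ∃ m : ℤ, IsOfFinAddOrder (P - m • (Point.some X Y h : (Atwo n).toAffine.Point)))
    (α : APoint (GenusField q)) (hα : GeneratesFreePart q α) :
    (¬ ((congruentNumberCurve l).analyticRank = 0 ∧ Nat.card ((congruentNumberCurve l).selmerGroup 4) = 2 ^ 4) →
      ((∀ L : ℤ, IsScriptL n L → (2 : ℤ) ∣ L ∧ ¬ (4 : ℤ) ∣ L) ↔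
        ((∃ y : APoint D.H, IsOfFinAddOrder (D.Z n - (2 : ℤ) • y)) ∧
          ¬ ∃ y : APoint D.H, IsOfFinAddOrder (D.Z n - (4 : ℤ) • y)))) ∧
    (((congruentNumberCurve l).analyticRank = 0 ∧ Nat.card ((congruentNumberCurve l).selmerGroup 4) = 2 ^ 4) →
      ((∀ L : ℤ, IsScriptL n L → (2 : ℤ) ∣ L ∧ ¬ (4 : ℤ) ∣ L) ↔
        ((∃ y : APoint D.H, IsOfFinAddOrder (D.Z n - (2 : ℤ) • y)) ∧
          ¬ ∃ y : APoint D.H, IsOfFinAddOrder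
            (D.Z n - Point.map (D.embK q (right_mem_divisors hl hq hn)) α - (4 : ℤ) • y)))) := by
  obtain ⟨u, hu, h35q⟩ := exists_h35_prime h12 hl hq (Or.inr hq8) hn D hPr.1 hBl α hα
  exact levelTwo_iff_genusPeriod_depth_of_facts hGZK hmod hCM0 h12 hl hq hl8 hq8 hn hr D hPr hC hρ h hs hX hgen hu h35q

/-- ★★★ **The `¬δ(l)` rows, with NO auxiliary object in the statement.**  Under the hypotheses of `levelTwo_iff_genusPeriod_depth` minus `α`
(a generator exists by GZK + conjunct 5): if `ord_{s=1} L(E_l, s) ≥ 2`, or `ord_{s=1} L(E_l,s) = 0` with `#Sel₄(E_l) ≠ 2⁴` (`Ш(E_l)[4] ≠ Ш(E_l)[2]`;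
for `ord L(E_l) = 0` this is `l = x² + 32y²` by Wang 2016), then **C⁺ at `lq` ⟺ the genus period `Z(lq)` has depth EXACTLY ONE in `A(ℍ′_{lq})/tors`.**
[cite: TianYuanZhang2017, §3.1, Thm. 3.5, Lemma 3.18, Thm. 1.2, §1 (1.1)] [cite: BurungaleFlach2024, Thm 1.1 / Cor. 3] [cite: Darmon2004, Thm. 3.22]
[cite: KoblitzECMF1993, Ch. II §5, Theorem (p. 84)] -/
theorem levelTwo_iff_genusPeriod_depth_eq_one (hGZK : rank_eq_analyticRank_of_analyticRank_le_one)
    (hmod : WeierstrassCurve.hasEntireLFunction_rat) (hCM0 : bsdTriple_of_hasCM_of_L_one_ne_zero) (h12 : thm12_parity_of_scriptL')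
    {l q : ℕ} (hl : l.Prime) (hq : q.Prime) (hl8 : l % 8 = 1) (hq8 : q % 8 = 7) (hn : n = l * q)
    (hr : (congruentNumberCurve n).analyticRank = 1)
    (D : GenusPointData n) (hPr : D.Printed) (hC : D.CMPointCompositumPrinted) (hBl : D.Thm35AtBlocks)
    (hρ : (rhoSubgroup n).index = 1)
    {X Y : ℚ} (h : (Atwo n).toAffine.Nonsingular X Y) {s : ℚ} (hs : s ≠ 0) (hX : X = 2 * s ^ 2)
    (hgen : ∀ P : (Atwo n).toAffine.Point, ∃ m : ℤ, IsOfFinAddOrder (P - m • (Point.some X Y h : (Atwo n).toAffine.Point)))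
    (hδ : ¬ ((congruentNumberCurve l).analyticRank = 0 ∧ Nat.card ((congruentNumberCurve l).selmerGroup 4) = 2 ^ 4)) :
    (∀ L : ℤ, IsScriptL n L → (2 : ℤ) ∣ L ∧ ¬ (4 : ℤ) ∣ L) ↔
      ((∃ y : APoint D.H, IsOfFinAddOrder (D.Z n - (2 : ℤ) • y)) ∧
        ¬ ∃ y : APoint D.H, IsOfFinAddOrder (D.Z n - (4 : ℤ) • y)) := by
  obtain ⟨α, hα, -⟩ := exists_generatesFreePart_prime hGZK h12 hq (Or.inr hq8)
  exact (levelTwo_iff_genusPeriod_depth hGZK hmod hCM0 h12 hl hq hl8 hq8 hn hr D hPr hC hBl hρ h hs hX hgen α hα).1 hδ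

end InvisibleR2

/-! ## §3b The partner-trivial half of R2 (`Ш(A_{lq})[2] = 0`; there `ρ(lq) = 1` and `#Sel₄ = 2⁶` are theorems, g20): C⁺ ⟺ the genus period is NOT 2-divisible -/

section PartnerHalf

/-- ★★★ **C⁺ ON R2 ∩ {`Ш(A_{lq})[2] = 0`} ⟺ `Z(lq) ∉ 2A(ℍ′_{lq}) + tors` — a LAYER-ONE law of the genus PERIOD, fully by name.**  Primes `l ≡ 1`,
`q ≡ 7 (mod 8)` with `(l/q) = (q/l) = 1`, `ord_{s=1} L(E_{lq}, s) = 1`, `#Sel₂(E_{lq}) = 2⁵`, `Ш(A_{lq})[2] = 0` (the «no-half» of R2; census: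
`l ≠ x² + 32y²`, typed conjecture F1-R2); granted GZK and conjuncts 2, 4, 5 of 𝔅_ram, and a display package `D` (`Printed` + CM-point layer + (B)).
g20's `PartnerSha.levelTwo_iff_genusPoint_not_twoDivisible_of_partner_R2` gave «C⁺ ⟺ `[P(lq)] ≠ 0`»; §2's layer one (`[P(lq)] = [Z(lq)]`, now
hypothesis-free) turns it into a statement about the genus period alone. [cite: TianYuanZhang2017, §1 (p0002 L101–L110), §3.1, Thm. 3.5, Lemma 3.18]
[cite: SilvermanAEC2009, Thm. X.4.2(a), Prop. X.4.9] [cite: Darmon2004, Thm. 3.22] [cite: BurungaleFlach2024, Thm 1.1 / Cor. 3] -/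
theorem levelTwo_iff_genusPeriod_not_twoDivisible_of_partner_R2 (hGZK : rank_eq_analyticRank_of_analyticRank_le_one)
    (hmod : WeierstrassCurve.hasEntireLFunction_rat) (hCM0 : bsdTriple_of_hasCM_of_L_one_ne_zero) (h12 : thm12_parity_of_scriptL')
    {l q : ℕ} [hlp : Fact l.Prime] [hqp : Fact q.Prime]
    (hl8 : l % 8 = 1) (hq8 : q % 8 = 7) (hlq : IsSquare ((l : ℤ) : ZMod q)) (hql : IsSquare ((q : ℤ) : ZMod l))
    (hr1 : haveI := isElliptic_congruentNumberCurve (Nat.mul_ne_zero hlp.out.ne_zero hqp.out.ne_zero);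
      (congruentNumberCurve (l * q)).analyticRank = 1)
    (h₂ : haveI := isElliptic_congruentNumberCurve (Nat.mul_ne_zero hlp.out.ne_zero hqp.out.ne_zero);
      Nat.card ((congruentNumberCurve (l * q)).selmerGroup 2) = 2 ^ 5)
    (hA : ∀ c ∈ (congruentNumberCurve (l * q)).twoIsogenyCodomain.sha, 2 • c = 0 → c = 0)
    (D : GenusPointData (l * q)) (hPr : D.Printed) (hC : D.CMPointCompositumPrinted) (hBl : D.Thm35AtBlocks) :
    (∀ L : ℤ, IsScriptL (l * q) L → (2 : ℤ) ∣ L ∧ ¬ (4 : ℤ) ∣ L) ↔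
      ¬ ∃ y : APoint D.H, IsOfFinAddOrder (D.Z (l * q) - (2 : ℤ) • y) := by
  rw [PartnerSha.levelTwo_iff_genusPoint_not_twoDivisible_of_partner_R2 hGZK hl8 hq8 hlq hql hr1 h₂ hA D hPr hC,
    twoDivisible_genusPoint_iff_genusPeriod hGZK hmod hCM0 h12 hlp.out hqp.out hl8 (Or.inr hq8) rfl D hPr.1 hPr.2.2.1 hPr.2.1 hBl]

end PartnerHalf

/-! ## §3c The VISIBLE part of both two-prime sectors (`[Q₁] ≠ 0`): C⁺ ⟺ `[Z(lm)] = [Q₁]`, digit-free and by name -/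

section Visible

variable {n : ℕ}

/-- ★★ **VISIBLE PART, DIGIT-FREE, BY NAME: C⁺ at `lm` ⟺ `Z(lm) − Q₁ ∈ 2A(ℍ′_{lm}) + tors`.**  Primes `l ≡ 1`, `m ≡ 5, 7 (mod 8)`, `n = lm` square-free
with `ord_{s=1} L(E_n, s) = 1`; granted GZK and conjuncts 2, 4, 5 of 𝔅_ram; display package `D` (`Printed` + (B)); `R` a generator of `E_n(ℚ)` modulo
torsion and `Q₁` a half of its twisted image (`φ_H(Q₁) = ι Θ_E(R)`) which is NOT `2`-divisible modulo torsion (the visible stratum).  g10's two visible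
theorems (`…_of_four_dvd` / `…_of_not_four_dvd`) carried the digit `𝓛(l)/2 mod 2`, `𝓛(m)` odd and `h35m`; at layer one the correction `c·α_m` is
invisible (`α_m ∈ 2A + tors`), so ONE statement covers both digits, and every auxiliary hypothesis is now a named fact or a display.
[cite: TianYuanZhang2017, Thm. 3.5 (p0011 L94–L100), §3.1 (p0011 L67–L73), Thm. 1.2] [cite: Darmon2004, Thm. 3.22] [cite: BurungaleFlach2024, Thm 1.1 / Cor. 3] -/
theorem levelTwo_two_primes_iff_visible (hGZK : rank_eq_analyticRank_of_analyticRank_le_one)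
    (hmod : WeierstrassCurve.hasEntireLFunction_rat) (hCM0 : bsdTriple_of_hasCM_of_L_one_ne_zero) (h12 : thm12_parity_of_scriptL')
    {l m : ℕ} (hl : l.Prime) (hm : m.Prime) (hl8 : l % 8 = 1) (hm8 : m % 8 = 5 ∨ m % 8 = 7) (hn : n = l * m) (hsq : Squarefree n)
    (hr : (congruentNumberCurve n).analyticRank = 1)
    (D : GenusPointData n) (hPr : D.Printed) (hBl : D.Thm35AtBlocks)
    {R : (congruentNumberCurve n).toAffine.Point} (hR : ∀ x, ∃ k : ℤ, IsOfFinAddOrder (x - k • R))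
    {Q₁ : APoint D.H} (hQ₁ : φH D Q₁ = Point.map (W' := curveA.twoIsogenyCodomain)
      (D.embK n (Nat.mem_divisors_self n hsq.ne_zero)) (ΘE hsq.ne_zero R))
    (hQ2 : ¬ ∃ y : APoint D.H, IsOfFinAddOrder (Q₁ - (2 : ℤ) • y)) :
    (∀ L : ℤ, IsScriptL n L → (2 : ℤ) ∣ L ∧ ¬ (4 : ℤ) ∣ L) ↔
      ∃ y : APoint D.H, IsOfFinAddOrder (D.Z n - Q₁ - (2 : ℤ) • y) := by
  have h8 : n % 8 = 5 ∨ n % 8 = 6 ∨ n % 8 = 7 := by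
    rw [hn, mul_mod_eight_of_one hl8]; rcases hm8 with h | h
    · exact Or.inl h
    · exact Or.inr (Or.inr h)
  have hLs : D.scriptLSpec := hPr.1
  have heps : D.epsSpec := hPr.2.1
  have hrec : D.recursion := hPr.2.2.1
  have h35 : D.thm35Main := hPr.2.2.2.2.1
  rw [LevelTwoHalfGenerator.levelTwo_iff_genusPoint_sub_half_twoDivisible hGZK hsq h8 hr D h35 hLs hR hQ₁ hQ2]
  -- `[P(lm)] = [Z(lm)]`: the correction `c·α_m` is `2`-divisible modulo torsion
  obtain ⟨c', hLl⟩ := exists_scriptL_left_eq_two_mul hmod hCM0 hl hm hl8 hn D hLs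
  obtain ⟨α, hα, -⟩ := exists_generatesFreePart_prime hGZK h12 hm hm8
  obtain ⟨u, hu, h35m⟩ := exists_h35_prime h12 hl hm hm8 hn D hLs hBl α hα
  obtain ⟨s, -, h⟩ := genusPoint_two_primes_congr hl hm hl8 hm8 hn D hrec heps hLl h35m
  obtain ⟨b, hb⟩ := twoDivisible_of_h35m D hu (odd_scriptL_right h12 hl hm hm8 hn D hLs) h35m
  refine twoDivisible_sub_iff ⟨-((s * c' * (u * D.scriptL m)) • b), ?_⟩
  have e : D.P n - D.Z n - (2 : ℤ) • (-((s * c' * (u * D.scriptL m)) • b)) =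
      (D.P n - (D.Z n - (s * c' * (u * D.scriptL m)) •
        Point.map (D.embK m (right_mem_divisors hl hm hn)) α)) +
      -((s * c' * (u * D.scriptL m)) • (Point.map (D.embK m (right_mem_divisors hl hm hn)) α - (2 : ℤ) • b)) := by
    module
  rw [e]
  exact h.add hb.zsmul.neg

end Visible

/-! ## §4 With the bundle 𝔅_ram of crux 20509 VERBATIM and the ONE named display fact -/

section Bundle

variable {n : ℕ}

/-- ★★★ **𝔅_ram VERBATIM + the display fact `tyz_genusPointBlockData` ⟹ the invisible-R2 reading of C⁺, `¬δ(l)` rows**: for primes `l ≡ 1`,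
`q ≡ 7 (mod 8)`, `n = lq` with `ord_{s=1} L(E_n,s) = 1`, there is a display package `D` of `n` (TYZ §3) such that, whenever the row has `ρ(n) = 0`
and an `A_n`-generator of shape `(2s², Y)`, and `¬δ(l)`: **C⁺ at `lq` ⟺ `Z(lq) ∈ 2A(ℍ′_n) + tors ∧ Z(lq) ∉ 4A(ℍ′_n) + tors`.**
[cite: TianYuanZhang2017, §3.1, Thm. 3.5, Lemma 3.18, Thm. 1.2, §1 (1.1)] [cite: BurungaleFlach2024, Thm 1.1 / Cor. 3] [cite: Darmon2004, Thm. 3.22]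
[cite: KoblitzECMF1993, Ch. II §5, Theorem (p. 84)] -/
theorem levelTwo_iff_genusPeriod_depth_eq_one_of_bundle
    (hB : (Literature.NumberTheory.EllipticCurves.rank_eq_analyticRank_of_analyticRank_le_one ∧ WeierstrassCurve.hasEntireLFunction_rat ∧ WeierstrassCurve.bsdRHS_eq_of_isIsogenous ∧ Literature.NumberTheory.EllipticCurves.bsdTriple_of_hasCM_of_L_one_ne_zero ∧ Literature.NumberTheory.EllipticCurves.TianYuanZhang2017.thm12_parity_of_scriptL' ∧ Literature.NumberTheory.EllipticCurves.Tian2014.thm13_rank_one_and_sha_odd ∧ Literature.NumberTheory.QuadraticFields.RedeiReichardt.redeiReichardt_fourTwoCard_classGroup ∧ Literature.NumberTheory.EllipticCurves.LiLiuTian2024.thm12_bsd_congruentNumberCurve ∧ Literature.NumberTheory.EllipticCurves.Monsky1990.cor515_rank_eq_one_and_card_selmerGroup_two ∧ Literature.NumberTheory.EllipticCurves.HeathBrown1994.monsky_card_selmerGroup_two_even ∧ Literature.NumberTheory.EllipticCurves.Tian2014.tian2014_system_sMinus_genus))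
    (hT : tyz_genusPointBlockData)
    {l q : ℕ} (hl : l.Prime) (hq : q.Prime) (hl8 : l % 8 = 1) (hq8 : q % 8 = 7) (hn : n = l * q)
    (hr : (congruentNumberCurve n).analyticRank = 1) :
    ∃ D : GenusPointData n, D.Printed ∧
      ((rhoSubgroup n).index = 1 →
        ∀ {X Y : ℚ} (h : (Atwo n).toAffine.Nonsingular X Y) {s : ℚ}, s ≠ 0 → X = 2 * s ^ 2 →
          (∀ P : (Atwo n).toAffine.Point, ∃ m : ℤ, IsOfFinAddOrder (P - m • (Point.some X Y h : (Atwo n).toAffine.Point))) →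
          ¬ ((congruentNumberCurve l).analyticRank = 0 ∧ Nat.card ((congruentNumberCurve l).selmerGroup 4) = 2 ^ 4) →
            ((∀ L : ℤ, IsScriptL n L → (2 : ℤ) ∣ L ∧ ¬ (4 : ℤ) ∣ L) ↔
              ((∃ y : APoint D.H, IsOfFinAddOrder (D.Z n - (2 : ℤ) • y)) ∧
                ¬ ∃ y : APoint D.H, IsOfFinAddOrder (D.Z n - (4 : ℤ) • y)))) := by
  obtain ⟨hsq, h7, -⟩ := sector_R2 hl hq hl8 hq8 hn
  obtain ⟨D, hPr, hC, hBl⟩ := hT n hsq (Or.inr (Or.inr h7))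
  exact ⟨D, hPr, fun hρ X Y h s hs hX hgen hδ =>
    levelTwo_iff_genusPeriod_depth_eq_one hB.1 hB.2.1 hB.2.2.2.1 hB.2.2.2.2.1 hl hq hl8 hq8 hn hr D hPr hC hBl hρ h hs hX hgen hδ⟩

end Bundle

end Summit.BirchSwinnertonDyer.PrintCf2.TwoPrimesByName

end
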